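import Summits.AtomisticToContinuum.FouriersLaw.Theses.MatthiessenLadder
import Literature.MathematicalPhysics.KineticTheory.CellChainLangevin
import Literature.MathematicalPhysics.KineticTheory.SiteChainWindowDecay
import HarnessLib

/-!
# `PrefixSteadyStates`, line `registered` — stub `stub_prefixWindowDecay`

Crux item `stmt-AtomisticToContinuum-12778` (route `MatthiessenLadder`, decl `…MatthiessenLadder.
PrefixSteadyStates`), skeleton r12: the probabilistic step of CEHR Theorem 5.1 for the Langevin
kernels of a cell chain `cellChain ω₂ lam β γ c` (`ω₂ > 0`, `lam, β ≥ 0`, `γ > 0`, `N ≥ 1`,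
`T_L, T_R > 0`). HYPOTHESES: the a-priori bound (3.4)
`P_t e^{θH}(z) ≤ e^{θγ(T_L+T_R)t} e^{θH(z)}` for `0 < θ < 1/max(T_L,T_R)` (displayed), `p > 1` with
`pθ < 1/max(T_L,T_R)`, and a pathwise energy drop `θH(Φ_w(z,B)) ≤ θH(z) - D` on the good event
`goodEvent a w` of the pair of bath Brownian motions. CONCLUSION: the window estimate
`P_w e^{θH}(z) ≤ e^{θH(z)} (e^{-D} + e^{θγ(T_L+T_R)w} P(goodEventᶜ)^{1-1/p})`.
A specialisation of the generic `SiteChain.UniformlyConfining.langevinKernel_window_decay_of_pathwise`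
(`Literature/…/SiteChainWindowDecay.lean`: split the expectation over the event, Hölder with
exponents `p, p/(p-1)` and (3.4) at `pθ` on the bad event) to the uniformly confining cell chain
(`cellChain_uniformlyConfining`).
-/

noncomputable section

namespace Summit.AtomisticToContinuum.FouriersLaw.Theorems.PrefixSteadyStates.LineRegistered

open MeasureTheory Filter Topology
open scoped NNReal ENNReal
open Literature.MathematicalPhysics.KineticTheory.HeatConduction
open Literature.MathematicalPhysics.KineticTheory Literature.Probability.Process

/-- **Stub: the window estimate from a pathwise energy drop, for the Langevin kernels of a cell
chain** (in place of CEHR Lemma 5.5). Given (3.4) for `0 < θ < 1/max(T_L,T_R)`, `p > 1` with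
`pθ < 1/max(T_L,T_R)` and `θH(Φ_w(z,B)) ≤ θH(z) - D` on `goodEvent a w`:
`P_w e^{θH}(z) ≤ e^{θH(z)} (e^{-D} + e^{θγ(T_L+T_R)w} P(goodEventᶜ)^{1-1/p})`.
[cite: CuneoEckmannHairerReyBellet2018, Lemma 5.5 and §3 eq. (3.4)] -/
theorem stub_prefixWindowDecay :
    ∀ ω₂ lam β γ : ℝ, 0 < ω₂ → 0 ≤ lam → 0 ≤ β → 0 < γ → ∀ (c : ℕ → Bool) (N : ℕ), 0 < N →
      ∀ T_L T_R : ℝ, 0 < T_L → 0 < T_R →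
        (∀ θ : ℝ, 0 < θ → θ < 1 / max T_L T_R → ∀ (t : ℝ≥0) (z : PhaseSpace N),
            ∫⁻ y, ENNReal.ofReal (Real.exp (θ * (cellChain ω₂ lam β γ c).hamiltonian N y))
                ∂((cellChain ω₂ lam β γ c).langevinKernel N T_L T_R t z) ≤
              ENNReal.ofReal (Real.exp (θ * γ * (T_L + T_R) * t) *
                Real.exp (θ * (cellChain ω₂ lam β γ c).hamiltonian N z))) →
        ∀ θ : ℝ, 0 < θ → ∀ p : ℝ, 1 < p → p * θ < 1 / max T_L T_R →
          ∀ (w : ℝ≥0) (a D : ℝ) (z : PhaseSpace N),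
            (∀ wp ∈ Literature.Probability.Process.goodEvent a w,
              θ * (cellChain ω₂ lam β γ c).hamiltonian N
                  ((cellChain ω₂ lam β γ c).langevinSolMap N T_L T_R w z
                    (Literature.Probability.Process.pairPath wp)) ≤
                θ * (cellChain ω₂ lam β γ c).hamiltonian N z - D) →
            ∫⁻ y, ENNReal.ofReal (Real.exp (θ * (cellChain ω₂ lam β γ c).hamiltonian N y))
                ∂((cellChain ω₂ lam β γ c).langevinKernel N T_L T_R w z) ≤
              ENNReal.ofReal (Real.exp (θ * (cellChain ω₂ lam β γ c).hamiltonian N z)) *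
                (ENNReal.ofReal (Real.exp (-D)) +
                  ENNReal.ofReal (Real.exp (θ * γ * (T_L + T_R) * w)) *
                    (Literature.Probability.Process.wienerPair
                      (Literature.Probability.Process.goodEvent a w)ᶜ) ^ (1 - p⁻¹)) := by
  intro ω₂ lam β γ hω hl hβ hγ c N _hN T_L T_R _hTL _hTR h34 θ hθ p hp hpθ w a D z hgood
  exact (cellChain_uniformlyConfining hω hl hβ hγ.le c).langevinKernel_window_decay_of_pathwise N
    h34 hθ hp hpθ w a D z hgood

end Summit.AtomisticToContinuum.FouriersLaw.Theorems.PrefixSteadyStates.LineRegistered
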